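import Summits.Ventures.LatticeQCDFlow.Exactness.IMHRejectionCurve
import Mathlib.Analysis.SpecialFunctions.ImproperIntegrals
import Mathlib.MeasureTheory.Integral.IntegralEqImproper
import HarnessLib

/-!
# The Smith–Tierney kernel function `T_{n+1}(v) = ∫_{u>v} (n+1) λ(u)ⁿ/u² du`

HONEST FRAMING: exact (Metropolis-corrected) sampling algorithms for lattice gauge theory;
figures of merit are autocorrelation/cost numbers at stated couplings and volumes; no
continuum-physics claim.  (SCALAR calibration rung S0-A: not a gauge result.)

Venture `LatticeQCDFlow` (cell pub-lqcd), topic `Exactness`; FANOUT row 2 (`s0-phi4`, FLOW arm).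
NEW WORK of the cell (leg 3 of the cell's proof of the Smith–Tierney exact `n`-step kernel of the
independence sampler — Smith–Tierney 1996; Theorem 5 of G. Wang, arXiv:2008.02455, NAMED ONLY),
over `IMHRejectionCurve.lean` and Mathlib's improper integrals.  Nothing is cited as a fact.

## What is proved (`w, q > 0` measurable integrable, `∫ q = 1`; `λ = rejCurve`, `Π = massLe`)

* `integrableOn_one_div_pow_Ioi` (`1/uᵏ` on `(c, ∞)`, `k ≥ 2`; `∫_c^∞ u⁻² = 1/c` is computed inline);
  `measurable_rejCurve` (on all of `ℝ`, by Fubini measurability);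
* `stKernel μ w q n v = ∫_{u>v} (n+1) λ(u)ⁿ/u² du` (`= T_{n+1}(v)`), `measurable_stKernel`,
  `stIntegrand_bounds`, `integrableOn_stIntegrand`, **`stKernel_zero`** (`T₁(v) = 1/v`),
  `stKernel_bounds` (`0 ≤ T_{n+1}(v) ≤ (n+1)/v`), `stKernel_sub_eq` / `stKernel_anti`
  (`T_{n+1}(v) − T_{n+1}(v') = ∫_{[v,v')} φₙ`, nonincreasing);
* `imhAcceptQ_mul_q` (`α(x,z) q(z) = w(z)/max(b(x), b(z))`), `key_pointwise_le`, `qMassLe_mono`,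
  `qMassLe_sub` (`P̃(u) − P̃(v) = ∫ 1[v < b ≤ u] q`) — pointwise inputs of the recursion identities
  (I1)/(I2) proved in `IMHSmithTierneyRecursion.lean`.
-/

namespace Summit.Ventures.LatticeQCDFlow.Exactness

open Real MeasureTheory Filter Set Topology intervalIntegral

variable {X : Type*} [MeasurableSpace X] {μ : Measure X} {w q : X → ℝ}

/-! ## Power integrals on `(v, ∞)` -/

/-- `u ↦ 1/uᵏ` is integrable on `(c, ∞)` for `c > 0` and every natural exponent `k ≥ 2`
(from Mathlib's `integrableOn_Ioi_rpow_of_lt`). -/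
theorem integrableOn_one_div_pow_Ioi {c : ℝ} (hc : 0 < c) {k : ℕ} (hk : 2 ≤ k) :
    IntegrableOn (fun u : ℝ => 1 / u ^ k) (Ioi c) := by
  have hk' : (-(k : ℝ)) < -1 := by
    have : (2 : ℝ) ≤ k := by exact_mod_cast hk
    linarith
  have h := integrableOn_Ioi_rpow_of_lt hk' hc
  refine h.congr_fun (fun u hu => ?_) measurableSet_Ioi
  have hu : 0 < u := hc.trans hu
  show u ^ (-(k : ℝ)) = 1 / u ^ k
  rw [Real.rpow_neg hu.le, Real.rpow_natCast, one_div]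

/-! ## Measurability of the rejection curve and of parametric half-line integrals -/

omit [MeasurableSpace X] in
/-- **The accepted proposal density**: `α(x,z) q(z) = w(z) / max(b(x), b(z))`, `b = w/q`. -/
theorem imhAcceptQ_mul_q (hw0 : ∀ t, 0 < w t) (hq0 : ∀ t, 0 < q t) (x z : X) :
    imhAcceptQ w q x z * q z = w z / max (w x / q x) (w z / q z) := by
  unfold imhAcceptQ
  have hwx := hw0 x; have hqx := hq0 x; have hwz := hw0 z; have hqz := hq0 z
  have e : w z * q x / (w x * q z) = (w z / q z) / (w x / q x) := by
    field_simp
  rw [e]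
  have hbx : 0 < w x / q x := div_pos hwx hqx
  have hbz : 0 < w z / q z := div_pos hwz hqz
  rcases le_or_gt (w z / q z) (w x / q x) with h | h
  · rw [min_eq_right ((div_le_one hbx).2 h), max_eq_left h]
    field_simp
  · rw [min_eq_left ((one_le_div hbx).2 h.le), max_eq_right h.le, one_mul]
    field_simp

omit [MeasurableSpace X] in
/-- Pointwise identity behind the `a ≤ c` case: `1[b ≤ c] w/max(a,b) = 1[b ≤ c] q − (1 − min(1, b/a)) q`
for `a ≤ c` (`a > 0`). -/
theorem key_pointwise_le (hw0 : ∀ t, 0 < w t) (hq0 : ∀ t, 0 < q t) {a c : ℝ} (ha : 0 < a)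
    (hac : a ≤ c) (z : X) :
    (if w z / q z ≤ c then w z / max a (w z / q z) else 0 : ℝ)
      = (if w z / q z ≤ c then q z else 0) - (1 - min 1 (w z / q z / a)) * q z := by
  have hqz := hq0 z; have hwz := hw0 z
  have hb : 0 < w z / q z := div_pos hwz hqz
  by_cases h : w z / q z ≤ c
  · rw [if_pos h, if_pos h]
    rcases le_or_gt (w z / q z) a with h1 | h1
    · rw [max_eq_left h1, min_eq_right ((div_le_one ha).2 h1)]
      field_simp
      ring
    · rw [max_eq_right h1.le, min_eq_left ((one_le_div ha).2 h1.le)]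
      field_simp
      ring
  · rw [if_neg h, if_neg h]
    have h1 : a ≤ w z / q z := hac.trans (not_le.1 h).le
    rw [min_eq_left ((one_le_div ha).2 h1)]
    ring

variable [SFinite μ]

/-- `λ` is measurable on `ℝ` (Fubini measurability of a jointly measurable integrand). -/
theorem measurable_rejCurve (hwm : Measurable w) (hqm : Measurable q) :
    Measurable (rejCurve μ w q) := by
  have hF : Measurable fun p : ℝ × X => (1 - min 1 (w p.2 / q p.2 / p.1)) * q p.2 :=
    (measurable_const.sub (measurable_const.min (((hwm.div hqm).comp measurable_snd).div
      measurable_fst))).mul (hqm.comp measurable_snd)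
  exact (hF.stronglyMeasurable.integral_prod_right' (ν := μ)).measurable

/-! ## The kernel function -/

/-- The Smith–Tierney kernel function of order `n + 1`:
`T_{n+1}(v) = ∫_{u > v} (n+1) λ(u)ⁿ / u² du` (so `T₁(v) = 1/v`). -/
noncomputable def stKernel (μ : Measure X) (w q : X → ℝ) (n : ℕ) (v : ℝ) : ℝ :=
  ∫ u in Ioi v, ((n : ℝ) + 1) * rejCurve μ w q u ^ n / u ^ 2

/-- The integrand `φₙ(u) = (n+1) λ(u)ⁿ/u²` is measurable. -/
theorem measurable_stIntegrand (hwm : Measurable w) (hqm : Measurable q) (n : ℕ) :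
    Measurable fun u : ℝ => ((n : ℝ) + 1) * rejCurve μ w q u ^ n / u ^ 2 :=
  (measurable_const.mul ((measurable_rejCurve hwm hqm).pow_const n)).div (measurable_id.pow_const 2)

omit [SFinite μ] in
/-- On `(0, ∞)`: `0 ≤ φₙ(u) ≤ (n+1)/u²` (`∫ q = 1`). -/
theorem stIntegrand_bounds (hw0 : ∀ t, 0 < w t) (hq0 : ∀ t, 0 < q t) (hqi : Integrable q μ)
    (hq1 : ∫ z, q z ∂μ = 1) (n : ℕ) {u : ℝ} (hu : 0 < u) :
    0 ≤ ((n : ℝ) + 1) * rejCurve μ w q u ^ n / u ^ 2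
    ∧ ((n : ℝ) + 1) * rejCurve μ w q u ^ n / u ^ 2 ≤ ((n : ℝ) + 1) * (1 / u ^ 2) := by
  obtain ⟨h0, h1⟩ := rejCurve_bounds hw0 hq0 hqi hu (μ := μ)
  rw [hq1] at h1
  have hn : (0 : ℝ) ≤ (n : ℝ) + 1 := by positivity
  have hp1 : rejCurve μ w q u ^ n ≤ 1 := pow_le_one₀ h0 h1
  refine ⟨div_nonneg (mul_nonneg hn (pow_nonneg h0 n)) (sq_nonneg _), ?_⟩
  rw [mul_one_div]
  exact div_le_div_of_nonneg_right (mul_le_of_le_one_right hn hp1) (sq_nonneg _)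

/-- `φₙ` is integrable on `(v, ∞)` for `v > 0`. -/
theorem integrableOn_stIntegrand (hw0 : ∀ t, 0 < w t) (hwm : Measurable w) (hq0 : ∀ t, 0 < q t)
    (hqm : Measurable q) (hqi : Integrable q μ) (hq1 : ∫ z, q z ∂μ = 1) (n : ℕ) {v : ℝ}
    (hv : 0 < v) :
    IntegrableOn (fun u : ℝ => ((n : ℝ) + 1) * rejCurve μ w q u ^ n / u ^ 2) (Ioi v) := by
  refine Integrable.mono' ((integrableOn_one_div_pow_Ioi hv (le_refl 2)).const_mul ((n : ℝ) + 1))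
    (measurable_stIntegrand hwm hqm n).aestronglyMeasurable ?_
  refine (ae_restrict_iff' measurableSet_Ioi).2 (Eventually.of_forall fun u hu => ?_)
  obtain ⟨h0, h1⟩ := stIntegrand_bounds hw0 hq0 hqi hq1 n (hv.trans hu) (μ := μ)
  rw [Real.norm_eq_abs, abs_of_nonneg h0]
  exact h1

omit [SFinite μ] in
/-- **`T₁(v) = 1/v`** (`v > 0`). -/
theorem stKernel_zero {v : ℝ} (hv : 0 < v) : stKernel μ w q 0 v = 1 / v := by
  -- `∫_{v}^{∞} du/u² = 1/v` (the same computation as in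
  -- `Literature.MeasureTheory.Group.SL2CoordSetIntegral.integral_Ioi_inv_sq`, kept inline)
  have hIoi : ∫ u in Ioi v, 1 / u ^ 2 = 1 / v := by
    have h := integral_Ioi_rpow_of_lt (by norm_num : (-2 : ℝ) < -1) hv
    have e : ∫ u in Ioi v, 1 / u ^ 2 = ∫ u in Ioi v, u ^ (-2 : ℝ) :=
      setIntegral_congr_fun measurableSet_Ioi fun u hu => by
        have hu : 0 < u := hv.trans hu
        show 1 / u ^ 2 = u ^ (-2 : ℝ)
        rw [Real.rpow_neg hu.le, Real.rpow_two, one_div]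
    rw [e, h, show (-2 : ℝ) + 1 = -1 by norm_num, Real.rpow_neg_one]
    have hv0 : v ≠ 0 := hv.ne'
    field_simp
  unfold stKernel
  simp only [Nat.cast_zero, zero_add, pow_zero, mul_one]
  exact hIoi

/-- `T_{n+1}` is measurable on `ℝ` (a parametric integral of a jointly measurable integrand). -/
theorem measurable_stKernel (hwm : Measurable w) (hqm : Measurable q) (n : ℕ) :
    Measurable (stKernel μ w q n) := by
  have hφ := measurable_stIntegrand (μ := μ) hwm hqm n
  have hF : Measurable fun p : ℝ × ℝ =>
      (Ioi p.1).indicator (fun u => ((n : ℝ) + 1) * rejCurve μ w q u ^ n / u ^ 2) p.2 := by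
    have e : (fun p : ℝ × ℝ =>
        (Ioi p.1).indicator (fun u => ((n : ℝ) + 1) * rejCurve μ w q u ^ n / u ^ 2) p.2)
        = fun p => if p.1 < p.2 then ((n : ℝ) + 1) * rejCurve μ w q p.2 ^ n / p.2 ^ 2 else 0 := by
      funext p
      simp only [Set.indicator_apply, Set.mem_Ioi]
    rw [e]
    exact Measurable.ite (measurableSet_lt measurable_fst measurable_snd) (hφ.comp measurable_snd)
      measurable_const
  have h := (hF.stronglyMeasurable.integral_prod_right' (ν := (volume : Measure ℝ))).measurable
  have e : stKernel μ w q n = fun v => ∫ u,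
      (Ioi v).indicator (fun u => ((n : ℝ) + 1) * rejCurve μ w q u ^ n / u ^ 2) u := by
    funext v
    unfold stKernel
    rw [MeasureTheory.integral_indicator measurableSet_Ioi]
  rw [e]
  exact h

/-- `0 ≤ T_{n+1}(v) ≤ (n+1)/v` for `v > 0`. -/
theorem stKernel_bounds (hw0 : ∀ t, 0 < w t) (hwm : Measurable w) (hq0 : ∀ t, 0 < q t)
    (hqm : Measurable q) (hqi : Integrable q μ) (hq1 : ∫ z, q z ∂μ = 1) (n : ℕ) {v : ℝ}
    (hv : 0 < v) : 0 ≤ stKernel μ w q n v ∧ stKernel μ w q n v ≤ ((n : ℝ) + 1) / v := by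
  unfold stKernel
  constructor
  · refine setIntegral_nonneg measurableSet_Ioi fun u hu => ?_
    exact (stIntegrand_bounds hw0 hq0 hqi hq1 n (hv.trans hu) (μ := μ)).1
  · calc ∫ u in Ioi v, ((n : ℝ) + 1) * rejCurve μ w q u ^ n / u ^ 2
        ≤ ∫ u in Ioi v, ((n : ℝ) + 1) * (1 / u ^ 2) := by
          refine setIntegral_mono_on (integrableOn_stIntegrand hw0 hwm hq0 hqm hqi hq1 n hv)
            ((integrableOn_one_div_pow_Ioi hv (le_refl 2)).const_mul _) measurableSet_Ioi fun u hu => ?_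
          exact (stIntegrand_bounds hw0 hq0 hqi hq1 n (hv.trans hu) (μ := μ)).2
      _ = ((n : ℝ) + 1) / v := by
          have h0 : stKernel μ w q 0 v = 1 / v := stKernel_zero hv
          unfold stKernel at h0
          simp only [Nat.cast_zero, zero_add, pow_zero, mul_one] at h0
          rw [MeasureTheory.integral_const_mul, h0]
          ring

/-- **`T_{n+1}` is nonincreasing on `(0, ∞)`**, with the difference formula
`T_{n+1}(v) − T_{n+1}(v') = ∫_{[v, v')} φₙ(u) du` for `0 < v ≤ v'`. -/
theorem stKernel_sub_eq (hw0 : ∀ t, 0 < w t) (hwm : Measurable w) (hq0 : ∀ t, 0 < q t)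
    (hqm : Measurable q) (hqi : Integrable q μ) (hq1 : ∫ z, q z ∂μ = 1) (n : ℕ) {v v' : ℝ}
    (hv : 0 < v) (hvv' : v ≤ v') :
    stKernel μ w q n v - stKernel μ w q n v'
      = ∫ u in Ico v v', ((n : ℝ) + 1) * rejCurve μ w q u ^ n / u ^ 2 := by
  unfold stKernel
  have hint := integrableOn_stIntegrand hw0 hwm hq0 hqm hqi hq1 n hv
  have eI : ∀ x : ℝ, ∫ u in Ioi x, ((n : ℝ) + 1) * rejCurve μ w q u ^ n / u ^ 2
      = ∫ u in Ici x, ((n : ℝ) + 1) * rejCurve μ w q u ^ n / u ^ 2 :=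
    fun x => (integral_Ici_eq_integral_Ioi).symm
  rw [eI v, eI v']
  have hunion : Ici v = Ico v v' ∪ Ici v' := (Ico_union_Ici_eq_Ici hvv').symm
  have hdisj : Disjoint (Ico v v') (Ici v') := by
    rw [Set.disjoint_left]
    intro u hu hu'
    exact (not_le.2 hu.2) hu'
  have hintIci : IntegrableOn (fun u : ℝ => ((n : ℝ) + 1) * rejCurve μ w q u ^ n / u ^ 2) (Ici v) := by
    rw [integrableOn_Ici_iff_integrableOn_Ioi]
    exact hint
  rw [hunion, setIntegral_union hdisj measurableSet_Ici (hintIci.mono_set Ico_subset_Ici_self)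
    (hintIci.mono_set (Ici_subset_Ici.2 hvv'))]
  ring

/-- Antitonicity of `T_{n+1}` on `(0, ∞)`. -/
theorem stKernel_anti (hw0 : ∀ t, 0 < w t) (hwm : Measurable w) (hq0 : ∀ t, 0 < q t)
    (hqm : Measurable q) (hqi : Integrable q μ) (hq1 : ∫ z, q z ∂μ = 1) (n : ℕ) {v v' : ℝ}
    (hv : 0 < v) (hvv' : v ≤ v') : stKernel μ w q n v' ≤ stKernel μ w q n v := by
  have h := stKernel_sub_eq hw0 hwm hq0 hqm hqi hq1 n hv hvv'
  have h0 : 0 ≤ ∫ u in Ico v v', ((n : ℝ) + 1) * rejCurve μ w q u ^ n / u ^ 2 :=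
    setIntegral_nonneg measurableSet_Ico fun u hu =>
      (stIntegrand_bounds hw0 hq0 hqi hq1 n (hv.trans_le hu.1) (μ := μ)).1
  linarith

/-! ## The `q`-level masses -/

omit [SFinite μ] in
/-- `P̃` is nondecreasing (hence measurable). -/
theorem qMassLe_mono (hwm : Measurable w) (hq0 : ∀ t, 0 < q t) (hqm : Measurable q)
    (hqi : Integrable q μ) : Monotone (qMassLe μ w q) := by
  intro u u' huu'
  obtain ⟨hi, -, -⟩ := integrable_qMassLe_integrand hwm hq0 hqm hqi u
  obtain ⟨hi', -, -⟩ := integrable_qMassLe_integrand hwm hq0 hqm hqi u'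
  unfold qMassLe
  refine integral_mono hi hi' fun z => ?_
  by_cases h : w z / q z ≤ u
  · rw [if_pos h, if_pos (h.trans huu')]
  · rw [if_neg h]
    split_ifs
    · exact (hq0 z).le
    · exact le_rfl

omit [SFinite μ] in
/-- `P̃(u) − P̃(v) = ∫ 1[v < b ≤ u] q dμ` for `v ≤ u`. -/
theorem qMassLe_sub (hwm : Measurable w) (hq0 : ∀ t, 0 < q t) (hqm : Measurable q)
    (hqi : Integrable q μ) {v u : ℝ} (hvu : v ≤ u) :
    qMassLe μ w q u - qMassLe μ w q v
      = ∫ z, (if v < w z / q z ∧ w z / q z ≤ u then q z else 0) ∂μ := by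
  obtain ⟨hi, -, -⟩ := integrable_qMassLe_integrand hwm hq0 hqm hqi u
  obtain ⟨hi', -, -⟩ := integrable_qMassLe_integrand hwm hq0 hqm hqi v
  unfold qMassLe
  rw [← integral_sub hi hi']
  refine integral_congr_ae (Eventually.of_forall fun z => ?_)
  show (if w z / q z ≤ u then q z else 0) - (if w z / q z ≤ v then q z else 0)
    = (if v < w z / q z ∧ w z / q z ≤ u then q z else 0 : ℝ)
  by_cases h1 : w z / q z ≤ v
  · rw [if_pos (h1.trans hvu), if_pos h1, if_neg (fun h => (not_lt.2 h1) h.1), sub_self]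
  · rw [if_neg h1, sub_zero]
    by_cases h2 : w z / q z ≤ u
    · rw [if_pos h2, if_pos ⟨not_le.1 h1, h2⟩]
    · rw [if_neg h2, if_neg (fun h => h2 h.2)]

end Summit.Ventures.LatticeQCDFlow.Exactness
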